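import Mathlib.RingTheory.IsAdjoinRoot
import Mathlib.RingTheory.Valuation.RankOne
import Mathlib.FieldTheory.Galois.Basic
import Mathlib.FieldTheory.Perfect
import Literature.AlgebraicGeometry.Resolution.TranscendenceDefect
import Literature.AlgebraicGeometry.CossartPiltant200819.LocalModels2008
import HarnessLib

/-!
# Cossart–Piltant 2008 — the valuation-theoretic statements (HAL §§4–9) as named facts

The numbered statements of V. Cossart, O. Piltant, *Resolution of singularities of threefolds in
positive characteristic I. Reduction to local uniformization on Artin–Schreier and purely
inseparable coverings*, J. Algebra 320 (2008) 1051–1082 (`CossartPiltant2008`), that make up the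
proof of its Theorem 7.2 (HAL numbering; = journal Thm 8.1) "local uniformization in the immediate
Artin–Schreier / purely inseparable case implies local uniformization of every rank-one,
residually algebraic `k`-valuation ring of a function field of transcendence degree three",
typed VERBATIM at Mathlib level in the abstract-tower idiom, each a `Prop`-valued NAMED FACT
(users take `(h : Cofinality)` etc.; nothing is asserted):

| decl | HAL | journal | content |
|---|---|---|---|
| `Cofinality` | Cor 4.6 | Cor 4.6 | local uniformizations are cofinal among local models |
| `GaloisApproximation` | Prop 6.2 (1) | Thm 7.2 (1) | `G_s(W/V) = G_s(R̃/R)`, `G_i(W/V) = G_i(R̃/R)` for `R ≥ R₀` |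
| `ClimbToInertiaField` | Cor 6.3 | Cor 7.3 | LU climbs from `K` to `K' ⊆ K^i` |
| `MonomialUniformization` | Prop 8.1 | Prop 6.2 | `√(fS) = √(m_{S₀}S) = (x₁⋯x_r)`, `W x_i` `ℚ`-independent |
| `PrimeDegreeAscent` | Prop 8.3 | Prop 6.3 | LU climbs along `[L:K] = ℓ` prime with `f = ℓ` or `e = ℓ` |
| `DescentBelowInertiaField` | Prop 9.3 | Prop 9.1 | LU descends from `K' ⊆ K^i` to `K`, with `R` below `S'` |
| `TamePrimeDescent` | Lemma 9.4 | (§9) | LU descends along Galois `[L:K] = ℓ ≠ p` |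
| `DescentBelowRamificationField` | Prop 9.5 | Prop 9.3 | LU descends from `K' ⊆ K^r` to `K` |
| `ArtinSchreierHypothesis k` | Thm 7.2, hypothesis | Thm 8.1 | LU in the immediate degree-`p` case over a local uniformization |
| `LU3RankOne k` | Thm 7.2, conclusion | Thm 8.1 | LU for rank one, `κ(V)/k` algebraic, `trdeg 3` |
| `ReductionToArtinSchreier` | Thm 7.2 | Thm 8.1 | the implication, for every `k` of characteristic `p > 0` |

Page references "HAL p. N" are to the manuscript hal-00139124 (see `LocalModels2008.lean`).
Idiom: "function field of transcendence degree three over `k`" = `(⊤ : IntermediateField k K).FG ∧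
Algebra.trdeg k K = 3`; "`k`-valuation ring" = `∀ c : k, algebraMap k K c ∈ O` (as in
`Resolution.LocalUniformizationInChar`); "rank one" = `Nonempty O.valuation.RankOne`; "`κ(O)/k`
algebraic" = `Resolution.residueTrdeg k O _ = 0`; "rational rank `r`" = `Resolution.ratRank W = r`;
"has a local uniformization" = `Resolution.IsLocallyUniformizable` (equivalently a regular local
model inside `K`, `CP2008.isLocallyUniformizable_iff_exists_isLocalUniformizationOf`); `V := W ∩ K`
= `W.comap (algebraMap K L)`.

Relation to `Resolution/ArithmeticalThreefoldsLocal*.lean`: there the same tower (cofinality,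
Cor 6.3, Prop 8.1, Prop 8.3, Lemma 9.4, descent) is formalised — and largely PROVED — in the frame
of Cossart–Piltant 2019 Prop 4.10 (complete regular local `S` of dimension three inside an
algebraically closed valued field); the present file records the 2008 statements over a ground
field `k` as printed, which that development does not state. Deliberately NOT here: Thm 2.1,
Prop 4.9, Prop 5.1 and [CP2] (`Threefolds2008.lean`); Props 4.1/4.2 (embedded resolution /
principalization: `Resolution.CossartJannsenSaito2020Embedded`, `Resolution.CossartPiltant2019Principalization`);
Prop 6.2 (2) (completions; not typed).
-/

noncomputable section

open Polynomial

namespace Literature.AlgebraicGeometry.CossartPiltant200819.CP2008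

open Literature.AlgebraicGeometry.Resolution

universe u

/-- **Cossart–Piltant 2008, Corollary 4.6** (HAL p. 15), VERBATIM: "Let `K/k` be a function field
of transcendence degree three and `V/k` be a valuation ring with `QF(V) = K` having a local
uniformization `R`. Then for any local model `R₀` of `V/k`, there exists a local uniformization
`R₁` of `V/k` such that `R₀ < R₁`." (`R₀ < R₁`: inclusion with domination — automatic, `V`
dominates both.) Any field `k` of characteristic `p > 0` (§3 standing assumption; the proof, from
Prop 4.2 = principalization in dimension three, is characteristic free). Tree counterpart in the
2019 frame: `Resolution.CossartPiltant2019Local.cofinality_of_principalization` (proved from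
`CossartPiltant2019Principalization`). [cite: CossartPiltant2008, Cor 4.6 (HAL p. 15)] -/
def Cofinality : Prop :=
  ∀ (k K : Type u) [Field k] [Field K] [Algebra k K], (⊤ : IntermediateField k K).FG →
    Algebra.trdeg k K = 3 → ∀ O : ValuationSubring K, (∀ c : k, algebraMap k K c ∈ O) →
      IsLocallyUniformizable k K O → ∀ R₀ : Subalgebra k K, IsLocalModelOf k K O R₀ →
        ∃ R₁ : Subalgebra k K, IsLocalUniformizationOf k K O R₁ ∧ R₀ ≤ R₁

/-- **Cossart–Piltant 2008, Proposition 6.2 (Galois approximation), part (1)** (HAL p. 17; =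
journal Thm 7.2 (1); = Cossart–Piltant 2019 Prop 4.13), VERBATIM: "Let `L/K` be a Galois extension
of function fields over `k` and let `W/k` be a `k`-valuation ring such that `QF(W) = L`. Let
`V := W ∩ K`. For any given normal local model `R` of `V/k`, let `R̃` be the unique normal local
model of `W/k` which lies above `R`, and let `R_s` (resp. `R_i`) be the splitting ring (resp.
inertia ring) of `R̃` over `R`. There exists a normal local model `R₀` of `V/k` such that for any
normal local model `R` of `V/k` dominating `R₀`, the following holds. (1) We have
`G_s(W/V) = G_s(R̃/R)` and `G_i(W/V) = G_i(R̃/R)`, i.e. `R_s = R̃^{G_s(W/V)}` and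
`R_i = R̃^{G_i(W/V)}`." with `G_s(R̃/R) := {g | g.R̃ = R̃}`, `G_i(R̃/R) := {g ∈ G_s(R̃/R) |
∀ x ∈ R̃, g.x ≡ x mod m_R̃}` (HAL p. 5 (2), (3)), `m_R̃ = {x ∈ R̃ : W(x) > 0}`. Characteristic free,
any transcendence degree ("function field" = finitely generated). Part (2) (completions:
`κ(R_r) = κ(R_i)`, `R̂_r ≃ κ(R_i)[[x]]/I` with diagonal action of `G_i/G_r`) is not typed here.
Used in the tree as `Resolution.CossartPiltant2019Local.exists_model_of_henselRoot_of_cofinal`.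
[cite: CossartPiltant2008, Prop 6.2 (1) (HAL p. 17)] -/
def GaloisApproximation : Prop :=
  ∀ (k K : Type u) [Field k] [Field K] [Algebra k K], (⊤ : IntermediateField k K).FG →
    ∀ (L : Type u) [Field L] [Algebra K L] [Algebra k L] [IsScalarTower k K L],
      FiniteDimensional K L → IsGalois K L →
      ∀ W : ValuationSubring L, (∀ c : k, algebraMap k L c ∈ W) →
        ∃ R₀ : Subalgebra k K, IsNormalLocalModelOf k K (W.comap (algebraMap K L)) R₀ ∧
          ∀ R : Subalgebra k K, IsNormalLocalModelOf k K (W.comap (algebraMap K L)) R → R₀ ≤ R →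
            ∀ σ : L ≃ₐ[K] L,
              (σ ∈ W.decompositionSubgroup K ↔
                σ '' normalModelAbove W R = normalModelAbove W R) ∧
              (InInertiaGroup K W σ ↔ (σ '' normalModelAbove W R = normalModelAbove W R ∧
                ∀ x ∈ normalModelAbove W R, W.valuation (σ x - x) < 1))

/-- **Cossart–Piltant 2008, Corollary 6.3** (HAL p. 20; = journal Cor 7.3), VERBATIM: "Let `L/K` be
a Galois extension of function fields of transcendence degree three over `k` and let `W/k` be a
`k`-valuation ring such that `QF(W) = L`. Let `V := W ∩ K`. Let `K'`, `K ⊆ K' ⊆ L` be an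
intermediate extension such that `K'` is contained in `K^i`, the inertia field of `W` over `V`.
Let `V' := W ∩ K'`. If `V/k` has a local uniformization, then `V'/k` has a local uniformization."
(`L/K` finite Galois.) Tree counterpart in the 2019 frame:
`Resolution.CossartPiltant2019Local.exists_model_inertiaField_of_cofinal` (proved modulo
cofinality). [cite: CossartPiltant2008, Cor 6.3 (HAL p. 20)] -/
def ClimbToInertiaField : Prop :=
  ∀ (k K : Type u) [Field k] [Field K] [Algebra k K], (⊤ : IntermediateField k K).FG →
    Algebra.trdeg k K = 3 →
    ∀ (L : Type u) [Field L] [Algebra K L] [Algebra k L] [IsScalarTower k K L],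
      FiniteDimensional K L → IsGalois K L →
      ∀ W : ValuationSubring L, (∀ c : k, algebraMap k L c ∈ W) →
        ∀ K' : IntermediateField K L, LeInertiaField K W K' →
          IsLocallyUniformizable k K (W.comap (algebraMap K L)) →
            IsLocallyUniformizable k K' (W.comap (algebraMap K' L))

/-- **Cossart–Piltant 2008, Proposition 8.1** (HAL p. 22; = journal Prop 6.2), VERBATIM: "Let `L/k`
be a function field of transcendence degree three and `W/k` be a `k`-valuation ring of `L` with
`QF(W) = L`, of rank one, rational rank `r` (`1 ≤ r ≤ 3`) and such that `κ(W)/k` is algebraic. Let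
`S₀` be a given normal local model of `W/k` and `f₀ ∈ S₀`, `f₀ ≠ 0`. Assume that there exists a
local uniformization of `W/k`. There exists `f ∈ m_{S₀}`, `f ≠ 0`, such that `f₀ | f`, and a local
uniformization `S` of `W/k` with r.s.p. `(x₁, x₂, x₃)` having the following properties: (1)
`S₀ < S` and `(S₀)_f = S_f`. (2) `√(fS) = √(m_{S₀}S) = (x₁⋯x_r)` and `W x₁, …, W x_r` are
linearly independent in `W_L ⊗_ℤ ℚ`." Rendering, elementwise in `L`: "r.s.p." = `m_S = {s ∈ S :
W(s) > 0}` is generated by `x₁, x₂, x₃` (`S` is regular of dimension three); `(S₀)_f = S_f` as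
sets of fractions `a/fⁿ`; in (2), given `f ∈ m_{S₀}` and `√(fS) = (x₁⋯x_r)S =: P`, the printed
`√(m_{S₀}S) = P` is equivalent to `m_{S₀} ⊆ P`, which is what is stated. Proof in print: Cor 4.6 and
Prop 4.1 (embedded resolution in dimension three). Tree counterpart in the 2019 frame:
`Resolution.CossartPiltant2019Local.exists_localRing_monomial_of_embeddedResolution` (proved from an
embedded-resolution hypothesis). [cite: CossartPiltant2008, Prop 8.1 (HAL p. 22)] -/
def MonomialUniformization : Prop :=
  ∀ (k L : Type u) [Field k] [Field L] [Algebra k L], (⊤ : IntermediateField k L).FG →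
    Algebra.trdeg k L = 3 →
    ∀ (W : ValuationSubring L) (hk : ∀ c : k, algebraMap k L c ∈ W), Nonempty W.valuation.RankOne →
      ∀ (r : ℕ) (hr : r ≤ 3), 1 ≤ r → ratRank W = r → residueTrdeg k W hk = 0 →
      ∀ S₀ : Subalgebra k L, IsNormalLocalModelOf k L W S₀ → ∀ f₀ : L, f₀ ∈ S₀ → f₀ ≠ 0 →
        IsLocallyUniformizable k L W →
        ∃ f : L, f ∈ S₀ ∧ W.valuation f < 1 ∧ f ≠ 0 ∧ (∃ c ∈ S₀, f = f₀ * c) ∧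
          ∃ (S : Subalgebra k L) (x : Fin 3 → L), IsLocalUniformizationOf k L W S ∧
            (∀ i, x i ∈ S ∧ W.valuation (x i) < 1) ∧
            (∀ s ∈ S, W.valuation s < 1 → ∃ a : Fin 3 → L, (∀ i, a i ∈ S) ∧ s = ∑ i, a i * x i) ∧
            S₀ ≤ S ∧
            {y : L | ∃ a ∈ S₀, ∃ n : ℕ, y = a * (f ^ n)⁻¹} =
              {y : L | ∃ a ∈ S, ∃ n : ℕ, y = a * (f ^ n)⁻¹} ∧
            (∀ s ∈ S, (∃ n : ℕ, 0 < n ∧ ∃ a ∈ S, s ^ n = a * f) ↔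
              (∃ a ∈ S, s = a * ∏ i : Fin r, x (Fin.castLE hr i))) ∧
            (∀ s ∈ S₀, W.valuation s < 1 → ∃ a ∈ S, s = a * ∏ i : Fin r, x (Fin.castLE hr i)) ∧
            QIndepValues W (fun i : Fin r => x (Fin.castLE hr i))

/-- **Cossart–Piltant 2008, Proposition 8.3** (HAL p. 24; = journal Prop 6.3), VERBATIM: "Let
`L/K` be an extension of function fields of transcendence degree three over `k` of prime degree
`l` and let `W/k` be a `k`-valuation ring of rank one such that `QF(W) = L`. Let `V := W ∩ K`.
Assume that either (1) `[L:K] = [κ(W):κ(V)]`, or (2) `[L:K] = |W_L/V_K|`. If `V/k` has a local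
uniformization, then `W/k` has a local uniformization." (No separability hypothesis: `l = p`
purely inseparable is allowed, "the proof of (2) … is not harder in the wildly ramified case
`l = p`", HAL p. 24.) (1)/(2) via the tree's `inertiaDegree` / `ramificationIndex`. Tree
counterpart in the 2019 frame: `Resolution.CossartPiltant2019Local.tameAscent_of_descent`.
[cite: CossartPiltant2008, Prop 8.3 (HAL p. 24)] -/
def PrimeDegreeAscent : Prop :=
  ∀ (k K : Type u) [Field k] [Field K] [Algebra k K], (⊤ : IntermediateField k K).FG →
    Algebra.trdeg k K = 3 →
    ∀ (L : Type u) [Field L] [Algebra K L] [Algebra k L] [IsScalarTower k K L],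
      (Module.finrank K L).Prime →
      ∀ W : ValuationSubring L, (∀ c : k, algebraMap k L c ∈ W) → Nonempty W.valuation.RankOne →
        (inertiaDegree K W = Module.finrank K L ∨ ramificationIndex K W = Module.finrank K L) →
          IsLocallyUniformizable k K (W.comap (algebraMap K L)) → IsLocallyUniformizable k L W

/-- **Cossart–Piltant 2008, Proposition 9.3** (HAL p. 27; = journal Prop 9.1; answers the
paper's Problem 9.1 in dimension three), VERBATIM: "Let `L/K` be a Galois extension of function
fields of transcendence degree three over `k` and let `W/k` be a `k`-valuation ring of rank one
such that `QF(W) = L` and `κ(W)/k` is algebraic. Let `V := W ∩ K`. Let `K'`, `K ⊆ K' ⊆ L` be an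
intermediate extension such that `K'` is contained in `K^i`, the inertia field of `W` over `V`.
Let `V' := W ∩ K'`. Assume that `V'/k` has a local uniformization `S'₀`. There exists a local
uniformization `S'` of `V'/k`, with `S'₀ < S'`, and a local uniformization `R` of `V/k` lying below
`S'`." The one input of Cossart–Piltant 2019 Prop 4.10 that `Resolution/ArithmeticalThreefoldsLocal*`
still assumes (binder `hC4` of `cossartPiltant2019ReductionP_of_cjs_of_descent`, together with
Prop 9.5). [cite: CossartPiltant2008, Prop 9.3 (HAL p. 27)] -/
def DescentBelowInertiaField : Prop :=
  ∀ (k K : Type u) [Field k] [Field K] [Algebra k K], (⊤ : IntermediateField k K).FG →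
    Algebra.trdeg k K = 3 →
    ∀ (L : Type u) [Field L] [Algebra K L] [Algebra k L] [IsScalarTower k K L],
      FiniteDimensional K L → IsGalois K L →
      ∀ (W : ValuationSubring L) (hk : ∀ c : k, algebraMap k L c ∈ W),
        Nonempty W.valuation.RankOne → residueTrdeg k W hk = 0 →
        ∀ K' : IntermediateField K L, LeInertiaField K W K' →
          ∀ S₀ : Subalgebra k K', IsLocalUniformizationOf k K' (W.comap (algebraMap K' L)) S₀ →
            ∃ S : Subalgebra k K', IsLocalUniformizationOf k K' (W.comap (algebraMap K' L)) S ∧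
              S₀ ≤ S ∧ ∃ R : Subalgebra k K,
                IsLocalUniformizationOf k K (W.comap (algebraMap K L)) R ∧ LiesBelow W R K' S

/-- **Cossart–Piltant 2008, Lemma 9.4** (HAL p. 29), VERBATIM: "Let `L/K` be a Galois extension
of function fields of transcendence degree three over `k` of prime degree `l ≠ p`. Let `W/k` be a
`k`-valuation ring of rank one such that `QF(W) = L` and `κ(W)/k` is algebraic. Let `V := W ∩ K`.
If `W/k` has a local uniformization, then `V/k` has a local uniformization." (`l ≠ p = char k`,
rendered `(l : K) ≠ 0`.) Tree counterpart in the 2019 frame: the tame cyclic descent inside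
`Resolution.CossartPiltant2019Local.tameAscent_of_descent` (`TameCyclicInvariants.lean`).
READING NOTE on the PRINTED PROOF (HAL p. 30, l. 3–65), recorded so that no reader takes that
proof as checked here: its step at HAL p. 30, l. 15–16 — "Also `S` is stable by `G`, since any
conjugate of `S` is dominated by `W`, hence equal to `S`" — is unjustified as printed (domination
by `W` alone does not force `gS = S`: an explicit instance with `R̃₀ = S₀ < S ∋ ζ_l`, every
conjugate of `S` dominated by `W`, and `gS ≠ S` is in the module docstring of
`TameDescent2008.lean`, re-derived independently by the cell's referee). What the sequel
(l. 16–65) uses is exactly the `G`-stability statement (S3\*) =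
`CP2008.GStableUniformizationAbove`, and `CP2008.tamePrimeDescent_of_viaStableModel`
(`TameDescent2008.lean`) proves the present named fact from `CP2008.TamePrimeDescentViaStableModel`
together with (S3\*); cell record: pub-hironaka GAPS §GA, G7-A21.S; referee recommendation
R-CP94-1. NOTHING is asserted by this note about the truth of the Lemma (= journal Lemma 9.2),
which stays a cited statement of a refereed paper used only as a hypothesis `(h :
TamePrimeDescent)`; no statement of `CossartPiltant2008` or `CossartPiltant2019` is refuted.
[cite: CossartPiltant2008, Lemma 9.4 (HAL p. 29)] -/
def TamePrimeDescent : Prop :=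
  ∀ (k K : Type u) [Field k] [Field K] [Algebra k K], (⊤ : IntermediateField k K).FG →
    Algebra.trdeg k K = 3 →
    ∀ (L : Type u) [Field L] [Algebra K L] [Algebra k L] [IsScalarTower k K L],
      FiniteDimensional K L → IsGalois K L →
      (Module.finrank K L).Prime → ((Module.finrank K L : ℕ) : K) ≠ 0 →
      ∀ (W : ValuationSubring L) (hk : ∀ c : k, algebraMap k L c ∈ W),
        Nonempty W.valuation.RankOne → residueTrdeg k W hk = 0 →
          IsLocallyUniformizable k L W → IsLocallyUniformizable k K (W.comap (algebraMap K L))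

/-- **Cossart–Piltant 2008, Proposition 9.5** (HAL p. 30; = journal Prop 9.3), VERBATIM: "Let
`L/K` be a Galois extension of function fields of transcendence degree three over `k` and let
`W/k` be a `k`-valuation ring of rank one such that `κ(W)/k` is algebraic and `QF(W) = L`. Let
`V := W ∩ K`. Let `K'`, `K ⊆ K' ⊆ L` be an intermediate extension such that `K'` is contained in
`K^r`, the ramification field of `W` over `V`. Let `V' := W ∩ K'`. If `V'/k` has a local
uniformization, then `V/k` has a local uniformization."
[cite: CossartPiltant2008, Prop 9.5 (HAL p. 30)] -/
def DescentBelowRamificationField : Prop :=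
  ∀ (k K : Type u) [Field k] [Field K] [Algebra k K], (⊤ : IntermediateField k K).FG →
    Algebra.trdeg k K = 3 →
    ∀ (L : Type u) [Field L] [Algebra K L] [Algebra k L] [IsScalarTower k K L],
      FiniteDimensional K L → IsGalois K L →
      ∀ (W : ValuationSubring L) (hk : ∀ c : k, algebraMap k L c ∈ W),
        Nonempty W.valuation.RankOne → residueTrdeg k W hk = 0 →
        ∀ K' : IntermediateField K L, LeRamificationField K W K' →
          IsLocallyUniformizable k K' (W.comap (algebraMap K' L)) →
            IsLocallyUniformizable k K (W.comap (algebraMap K L))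

/-- The **conclusion of Cossart–Piltant 2008, Theorem 7.2** for the ground field `k` (HAL p. 20;
= journal Thm 8.1): "for every function field `K` of transcendence degree three over `k`, every
`k`-valuation ring `V/k` of rank one such that `κ(V)/k` is algebraic and `QF(V) = K` has a local
uniformization". [cite: CossartPiltant2008, Thm 7.2 (HAL p. 20, conclusion)] -/
def LU3RankOne (k : Type u) [Field k] : Prop :=
  ∀ (K : Type u) [Field K] [Algebra k K], (⊤ : IntermediateField k K).FG → Algebra.trdeg k K = 3 →
    ∀ (O : ValuationSubring K) (hk : ∀ c : k, algebraMap k K c ∈ O), Nonempty O.valuation.RankOne →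
      residueTrdeg k O hk = 0 → IsLocallyUniformizable k K O

/-- The **hypothesis of Cossart–Piltant 2008, Theorem 7.2** for the ground field `k` (HAL
pp. 19–20; = journal Thm 8.1) — local uniformization in the IMMEDIATE Artin–Schreier / purely
inseparable degree-`p` case, VERBATIM: "for every function field `K` of transcendence degree three
over `k`, for every `k`-valuation ring `V/k` of rank one such that `κ(V)/k` is algebraic and
`QF(V) = K`, and for every local uniformization `R` of `V/k`, the following holds: 'For every pair
`f, g ∈ m_R` (with `g ≠ 0` if `k` is perfect) such that (1) the polynomial
`h := X^p − g^{p−1}X + f ∈ R[X]` is irreducible over `K`, and (2) there exists a unique extension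
`W` of `V` to `L := QF(S)`, where `S := (R[X]/(h))_{(m_R,X)}`, and `V ⊂ W` is immediate, there
exists a local uniformization of `W/k`.'" Rendering: `p = char k`; `R` a local uniformization in
the sense of §3 (`IsLocalUniformizationOf`); "`f, g ∈ m_R`" = `f, g ∈ R` with `V(f), V(g) > 0`;
`L` any field extension of `K` generated by a root of `h` (`IsAdjoinRoot L h`, i.e.
`L ≅ K[X]/(h) = QF(S)`); the extensions of `V` to `L` are the `W` with `W ∩ K = V`; "immediate" =
Def 7.1 (`IsImmediate K W`); the root of `h` lies in `m_W` automatically, so `W` dominates `S` as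
in the paper. This is exactly what Cossart–Piltant 2009's Main theorem supplies for `k`
differentially finite over a perfect field (`Threefolds2008.lean`).
[cite: CossartPiltant2008, Thm 7.2 (HAL pp. 19–20, hypothesis) and Def 7.1] -/
def ArtinSchreierHypothesis (k : Type u) [Field k] : Prop :=
  ∀ (p : ℕ), p.Prime → CharP k p →
  ∀ (K : Type u) [Field K] [Algebra k K], (⊤ : IntermediateField k K).FG → Algebra.trdeg k K = 3 →
  ∀ (O : ValuationSubring K) (hk : ∀ c : k, algebraMap k K c ∈ O), Nonempty O.valuation.RankOne →
    residueTrdeg k O hk = 0 →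
  ∀ (R : Subalgebra k K), IsLocalUniformizationOf k K O R →
  ∀ (f g : K), f ∈ R → g ∈ R → O.valuation f < 1 → O.valuation g < 1 →
    (PerfectField k → g ≠ 0) →
    Irreducible (X ^ p - C (g ^ (p - 1)) * X + C f : K[X]) →
  ∀ (L : Type u) [Field L] [Algebra K L] [Algebra k L] [IsScalarTower k K L],
    Nonempty (IsAdjoinRoot L (X ^ p - C (g ^ (p - 1)) * X + C f : K[X])) →
  ∀ (W : ValuationSubring L), W.comap (algebraMap K L) = O →
    (∀ W' : ValuationSubring L, W'.comap (algebraMap K L) = O → W' = W) →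
    IsImmediate K W → IsLocallyUniformizable k L W

/-- **Cossart–Piltant 2008, Theorem 7.2** (HAL pp. 19–20; = journal Thm 8.1): "Let `k` be a field
of characteristic `p > 0`. Assume that [`ArtinSchreierHypothesis k`] holds. Then [`LU3RankOne k`]."
Proof in print (HAL pp. 20–30, Abhyankar's strategy): transcendence basis and `V₀ = V ∩ k(x₁,x₂,x₃)`
uniformized on `ℙ³_k`; the purely inseparable part by Prop 8.3 / the hypothesis with `g = 0`;
Galois closure, Cor 6.3 (climb to the inertia field), Prop 8.3 (2) (tame abelian prime steps), the
hypothesis (immediate degree-`p` steps inside the ramification group, a `p`-group), then descent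
by Lemma 9.4, Prop 9.3 and Prop 9.5. A NAMED FACT. [cite: CossartPiltant2008, Thm 7.2 (HAL pp. 19–20)] -/
def ReductionToArtinSchreier : Prop :=
  ∀ (k : Type u) [Field k] (p : ℕ) [Fact p.Prime] [CharP k p],
    ArtinSchreierHypothesis k → LU3RankOne k

/-! ### Sanity lemmas (bookkeeping only) -/

/-- Under `ReductionToArtinSchreier`, the hypothesis for `k` gives the rank-one statement for `k`
(the shape in which `Threefolds2008.lu3_of_leaves` consumes Theorem 7.2). [folklore] -/
theorem ReductionToArtinSchreier.lu3RankOne (h : ReductionToArtinSchreier.{u}) {k : Type u}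
    [Field k] {p : ℕ} [Fact p.Prime] [CharP k p] (hAS : ArtinSchreierHypothesis k) :
    LU3RankOne k :=
  h k p hAS

/-- `K ⊆ K^i ⊆ K^r`: descent below the ramification field contains descent below the inertia
field as the special case `K' ⊆ K^i` (given the local uniformization of `V'` outright).
[folklore] -/
theorem DescentBelowRamificationField.of_leInertiaField (h : DescentBelowRamificationField.{u})
    (k K : Type u) [Field k] [Field K] [Algebra k K] (hfg : (⊤ : IntermediateField k K).FG)
    (h3 : Algebra.trdeg k K = 3) (L : Type u) [Field L] [Algebra K L] [Algebra k L]
    [IsScalarTower k K L] (hfin : FiniteDimensional K L) (hgal : IsGalois K L)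
    (W : ValuationSubring L) (hk : ∀ c : k, algebraMap k L c ∈ W)
    (h1 : Nonempty W.valuation.RankOne) (halg : residueTrdeg k W hk = 0)
    (K' : IntermediateField K L) (hK' : LeInertiaField K W K')
    (hLU : IsLocallyUniformizable k K' (W.comap (algebraMap K' L))) :
    IsLocallyUniformizable k K (W.comap (algebraMap K L)) :=
  h k K hfg h3 L hfin hgal W hk h1 halg K' (hK'.leRamificationField K W) hLU

end Literature.AlgebraicGeometry.CossartPiltant200819.CP2008

end
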